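import Summits.AtomisticToContinuum.HydrodynamicLimit.Theses.OneSphereInfluence
import Summits.AtomisticToContinuum.HydrodynamicLimit.Theorems.OneSphereInfluenceAssemblyCore
import Literature.Analysis.FluidPDE.LinearizedHsEulerFamily
import HarnessLib

/-!
# Route `OneSphereInfluence`: the assembly item (stmt-AtomisticToContinuum-14700)

`Assembly : ScoreLinearResponse → ResamplingInfluence → HardCorePoincare → HomogeneousInvariance →
PreShockHomotopy → HydrodynamicLimit` — the three one-sphere cruxes and the two anchoring
statements imply the conjunct. This file proves it (`oneSphereInfluence_assembly`), i.e. the glue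
mathematics `MeanVarianceL2` + `L2ToHydroLimit` of the route thesis:

1. fix profiles `(a₁, u₁, θ₁)`; take `Λ, σ_P` from `PreShockHomotopy`, `σ_S` from
   `ScoreLinearResponse` (with this `Λ`), `σ_R`, `σ_H` from `ResamplingInfluence`,
   `HardCorePoincare`; `σ₀ = min`;
2. for `σ < σ₀`, a classical solution `(ρ, u, θ)` on `[0,T)`, flows `Φ`, matching data at `t = 0`
   and `t < T`: `PreShockHomotopy` gives `T' > t`, the path `κ ↦ (a_κ, u₀κ, θ₀κ)` from constants
   to `(a₁, u₁, θ₁)` and the jointly smooth family `U_κ` of solutions on `[0,T')` with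
   `U₁ = (ρ,u,θ)`, `U₀` constant, all laws probability measures;
3. for each field `F_N = ⟨U_N(t), χ⟩` (density, momentum coordinates, energy):
   `ScoreLinearResponse` gives `Cov_{p_κ^N}(S_κ, F_N) → ∂_κ⟨U_κ(t),χ⟩` uniformly in `κ`; the
   finite-`N` score identity `d/dκ E_{p_κ}F = Cov(S_κ,F)` and the mean value inequality give
   `E_{p_1}F_N - E_{p_0}F_N → ⟨U_1(t),χ⟩ - ⟨U_0(t),χ⟩`; `HomogeneousInvariance` + the `κ = 0` law
   of large numbers at time `0` + uniform `L²` bounds give `E_{p_0}F_N → ⟨U_0(0),χ⟩ = ⟨U_0(t),χ⟩`;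
   `HardCorePoincare` (with `F_N ∈ L²` by energy conservation) and `ResamplingInfluence` give
   `Var_{p_1}F_N → 0`; Chebyshev concludes (`tendsto_measure_lt_of_uniform_covariance`).

References: H. Spohn, *Large Scale Dynamics of Interacting Particles* (1991), Part I Ch. 3,
Part II §7.1; B. Efron, C. Stein, Ann. Statist. 9 (1981) 586–596 (variance bookkeeping).
-/

noncomputable section

open MeasureTheory ProbabilityTheory Filter Set Topology Real
open scoped InnerProductSpace ENNReal

namespace Summit.AtomisticToContinuum.HydrodynamicLimit.Theorems

open Literature.Analysis.FluidPDE Literature.MathematicalPhysics.KineticTheory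
open Summit.AtomisticToContinuum.HydrodynamicLimit.Theses.OneSphereInfluence
open OneSphereInfluenceAssembly

/-! ## Small conversions -/

namespace OneSphereInfluenceAssembly

/-- The infimum of a continuous positive function on the torus is positive. [folklore] -/
theorem iInf_pos_of_continuous {f : T3 → ℝ} (hf : Continuous f) (h0 : ∀ x, 0 < f x) : 0 < ⨅ y, f y := by
  obtain ⟨x₀, -, hx₀⟩ := isCompact_univ.exists_isMinOn univ_nonempty hf.continuousOn
  exact lt_of_lt_of_le (h0 x₀) (le_ciInf fun y => hx₀ (mem_univ y))

/-- A coordinate of the tested vector field `∫ (χ ρ) • w` is `∫ χ ρ wₗ`. [folklore] -/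
theorem integral_smul_apply {χ r : T3 → ℝ} {w : T3 → V3} (hχ : Continuous χ) (hr : Continuous r)
    (hw : Continuous w) (l : Fin 3) :
    (∫ x, (χ x * r x) • w x) l = ∫ x, χ x * r x * w x l := by
  have hint : Integrable (fun x => (χ x * r x) • w x) := integrable_of_continuous_T3 ((hχ.mul hr).smul hw)
  rw [show (∫ x, (χ x * r x) • w x) l = (EuclideanSpace.proj l : V3 →L[ℝ] ℝ) (∫ x, (χ x * r x) • w x) from rfl,
    ← ContinuousLinearMap.integral_comp_comm _ hint]
  refine integral_congr_ae (Eventually.of_forall fun x => ?_)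
  simp only [EuclideanSpace.coe_proj, PiLp.smul_apply, smul_eq_mul]

/-- From convergence in probability of a vector to that of a coordinate. [folklore] -/
theorem tendsto_measure_lt_abs_apply_of_norm {Ω : ℕ → Type*} [∀ N, MeasurableSpace (Ω N)]
    {P : (N : ℕ) → Measure (Ω N)} {W : (N : ℕ) → Ω N → V3} {δ : ℝ}
    (h : Tendsto (fun N => P N {z | δ < ‖W N z‖}) atTop (𝓝 0)) (l : Fin 3) :
    Tendsto (fun N => P N {z | δ < |W N z l|}) atTop (𝓝 0) :=
  tendsto_of_tendsto_of_tendsto_of_le_of_le tendsto_const_nhds h (fun N => zero_le) fun N =>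
    measure_mono fun z hz => lt_of_lt_of_le hz (by simpa using PiLp.norm_apply_le (p := 2) (W N z) l)

/-- Squeeze for variances: `0 ≤ V_N ≤ C S_N`, `S_N → 0` give `V_N → 0`. [folklore] -/
theorem tendsto_zero_of_le_mul {V S : ℕ → ℝ} {C : ℝ} (hV0 : ∀ N, 0 ≤ V N) (hle : ∀ N, V N ≤ C * S N)
    (hS : Tendsto S atTop (𝓝 0)) : Tendsto V atTop (𝓝 0) :=
  squeeze_zero hV0 hle (by simpa using hS.const_mul C)

end OneSphereInfluenceAssembly

/-! ## The assembly -/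

/-- **Route `OneSphereInfluence`, assembly item (stmt-AtomisticToContinuum-14700).** The three
one-sphere cruxes `ScoreLinearResponse`, `ResamplingInfluence`, `HardCorePoincare`, the support
`HomogeneousInvariance` and the pre-shock homotopy `PreShockHomotopy` imply the conjunct
`HydrodynamicLimit` (mean from the score identity + FTC/mean-value in `κ` anchored at the
flow-invariant constant state, variance from Poincaré × resampling influence, then Chebyshev).
[folklore] -/
theorem oneSphereInfluence_assembly :
    Summit.AtomisticToContinuum.HydrodynamicLimit.Theses.OneSphereInfluence.Assembly := by
  intro hS hR hH hI hP a₁ θ₁ u₁ ha₁ hθ₁ hu₁ ha₁0 hθ₁0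
  obtain ⟨Λ, hΛ, σP, hσP, hPσ⟩ := hP a₁ θ₁ u₁ ha₁ hθ₁ hu₁ ha₁0 hθ₁0
  obtain ⟨σS, hσS, hSσ⟩ := hS a₁ θ₁ u₁ ha₁ hθ₁ hu₁ ha₁0 hθ₁0 Λ hΛ
  obtain ⟨σR, hσR, hRσ⟩ := hR a₁ θ₁ u₁ ha₁ hθ₁ hu₁ ha₁0 hθ₁0
  obtain ⟨σH, hσH, hHσ⟩ := hH a₁ θ₁ u₁ ha₁ hθ₁ hu₁ ha₁0 hθ₁0
  refine ⟨min (min σP σS) (min σR σH), lt_min (lt_min hσP hσS) (lt_min hσR hσH), ?_⟩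
  intro σ hσ hσlt T ρ θ u hsol Φ hinit t ht
  have hσP' : σ < σP := lt_of_lt_of_le hσlt ((min_le_left _ _).trans (min_le_left _ _))
  have hσS' : σ < σS := lt_of_lt_of_le hσlt ((min_le_left _ _).trans (min_le_right _ _))
  have hσR' : σ < σR := lt_of_lt_of_le hσlt ((min_le_right _ _).trans (min_le_left _ _))
  have hσH' : σ < σH := lt_of_lt_of_le hσlt ((min_le_right _ _).trans (min_le_right _ _))
  -- the pre-shock homotopy through `t`
  obtain ⟨T', htT', a, θ₀, u₀, ρh, θh, uh, ha, hθs, hus, hhull, hconst, ha1, hθ1, hu1, hsols, hρc, huc, hθc,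
    hlln, hprobL, hρ1, hu1', hθ1', hconst0⟩ := hPσ σ hσ hσP' T ρ θ u hsol Φ hinit t ht
  obtain ⟨C, hC, hPI⟩ := hHσ σ hσ hσH'
  have hRt := hRσ σ hσ hσR' T ρ θ u hsol Φ hinit t ht
  subst ha1 hθ1 hu1 hρ1 hu1' hθ1'
  have htI : t ∈ Ico 0 T' := ⟨ht.1, htT'⟩
  have hT' : (0 : ℝ) < T' := ht.1.trans_lt htT'
  have h0T : (0 : ℝ) ∈ Ico 0 T' := ⟨le_rfl, hT'⟩
  have h0I : (0 : ℝ) ∈ Icc (0 : ℝ) 1 := ⟨le_rfl, zero_le_one⟩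
  have h1I : (1 : ℝ) ∈ Icc (0 : ℝ) 1 := ⟨zero_le_one, le_rfl⟩
  have hSt := hSσ σ hσ hσS' a θ₀ u₀ ha hθs hus hhull hconst rfl rfl rfl T' ρh θh uh hsols hρc huc hθc Φ hlln t htI
  -- positivity of the path profiles
  have hinf : 0 < Λ⁻¹ * ⨅ y, a 1 y :=
    mul_pos (inv_pos.2 (zero_lt_one.trans_le hΛ)) (iInf_pos_of_continuous ha₁ ha₁0)
  have ha0 : ∀ κ ∈ Icc (0 : ℝ) 1, ∀ x, 0 < a κ x := fun κ hκ x => hinf.trans_le (hhull κ hκ x).1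
  have hθ0 : ∀ κ ∈ Icc (0 : ℝ) 1, ∀ x, 0 < θ₀ κ x := fun κ hκ x => (hhull κ hκ x).2.2
  have hprobM : ∀ κ ∈ Icc (0 : ℝ) 1, ∀ N, IsProbabilityMeasure (localGibbsMeasure σ (a κ) (u₀ κ) (θ₀ κ) N) :=
    fun κ hκ N => by rw [← localGibbsLaw_eq σ _ _ _ N (Φ N)]; exact hprobL κ hκ N
  -- the constant state at `κ = 0`
  have hcpos : 0 < a 0 0 := ha0 0 h0I 0
  have hθcpos : 0 < θ₀ 0 0 := hθ0 0 h0I 0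
  have hlaw0 : ∀ N, localGibbsLaw σ (a 0) (u₀ 0) (θ₀ 0) N (Φ N) =
      localGibbsLaw σ (fun _ => a 0 0) (fun _ => u₀ 0 0) (fun _ => θ₀ 0 0) N (Φ N) := fun N => by
    congr 1 <;> funext x
    exacts [(hconst x).1, (hconst x).2.2, (hconst x).2.1]
  have hmeas0 : ∀ N, localGibbsMeasure σ (a 0) (u₀ 0) (θ₀ 0) N =
      localGibbsMeasure σ (fun _ => a 0 0) (fun _ => u₀ 0 0) (fun _ => θ₀ 0 0) N := fun N => by
    rw [← localGibbsLaw_eq σ _ _ _ N (Φ N), hlaw0, localGibbsLaw_eq]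
  have hinv : ∀ (N : ℕ) (s : ℝ), (Φ N).lawAt (localGibbsLaw σ (fun _ => a 0 0) (fun _ => u₀ 0 0)
      (fun _ => θ₀ 0 0) N (Φ N)) s = localGibbsLaw σ (fun _ => a 0 0) (fun _ => u₀ 0 0) (fun _ => θ₀ 0 0) N (Φ N) :=
    fun N s => hI σ (a 0 0) (θ₀ 0 0) (u₀ 0 0) hσ hcpos hθcpos N (Φ N) s
  have hprobc : ∀ N, IsProbabilityMeasure (localGibbsMeasure σ (fun _ => a 0 0) (fun _ => u₀ 0 0)
      (fun _ => θ₀ 0 0) N) := fun N => by rw [← hmeas0]; exact hprobM 0 h0I N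
  -- continuity of the slices of the Euler family
  have hρcont : ∀ κ ∈ Icc (0 : ℝ) 1, Continuous (ρh κ t) := fun κ hκ =>
    ((hsols κ hκ).smooth_density.isSmooth_slice htI).continuous
  have hucont : ∀ κ ∈ Icc (0 : ℝ) 1, Continuous (uh κ t) := fun κ hκ =>
    ((hsols κ hκ).smooth_velocity.isSmooth_slice htI).continuous
  have hρcont0 : Continuous (ρh 0 0) := ((hsols 0 h0I).smooth_density.isSmooth_slice h0T).continuous
  have hucont0 : Continuous (uh 0 0) := ((hsols 0 h0I).smooth_velocity.isSmooth_slice h0T).continuous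
  intro χ hχ δ hδ
  obtain ⟨Cχ, hCχ0, hCχ⟩ := exists_forall_abs_le_of_continuous hχ
  have hSχ := hSt χ hχ
  have hRχ := hRt χ hχ
  dsimp only at hSχ hRχ
  obtain ⟨hSd, hSm, hSe⟩ := hSχ
  obtain ⟨hRd, hRm, hRe⟩ := hRχ
  simp_rw [localGibbsLaw_eq] at hSd hSm hSe hRd hRm hRe hPI ⊢
  -- the common core, for one scalar observable
  have core : ∀ (F₀ : (N : ℕ) → Config (N + 1) (Fin 3) T3 → ℝ) (G : ℝ → ℝ) (k : Fin 5),
      (∀ N, Continuous (F₀ N)) →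
      (∀ N z, |F₀ N z| ≤ Cχ * (1 + (((N + 1 : ℕ) : ℝ))⁻¹ * ∑ i, ‖(z i).2‖ ^ 2)) →
      (∀ N, ∀ z ∈ (Φ N).good, |F₀ N ((Φ N).flow t z)| ≤ Cχ * (1 + (((N + 1 : ℕ) : ℝ))⁻¹ * ∑ i, ‖(z i).2‖ ^ 2)) →
      (∀ κ, G κ = ∫ x, χ x * (consState (ρh κ t x) (uh κ t x) (θh κ t x)) k) →
      ∀ c₀ : ℝ, c₀ = G 0 →
      TendstoUniformlyOn (fun N κ => cov[fun z => ∑ i, derivWithin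
          (fun κ' => Real.log (localGibbsProfile (a κ') (u₀ κ') (θ₀ κ') (z i))) (Icc 0 1) κ,
          fun z => F₀ N ((Φ N).flow t z); localGibbsMeasure σ (a κ) (u₀ κ) (θ₀ κ) N])
        (fun κ => derivWithin G (Icc 0 1) κ) atTop (Icc 0 1) →
      (∀ δ' > (0 : ℝ), Tendsto (fun N => localGibbsLaw σ (a 0) (u₀ 0) (θ₀ 0) N (Φ N)
        {z | δ' < |F₀ N ((Φ N).flow 0 z) - c₀|}) atTop (𝓝 0)) →
      Tendsto (fun N => ∑ i : Fin (N + 1), ∫ z, condVar (MeasurableSpace.comap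
          (fun (z : Config (N + 1) (Fin 3) T3) (j : Fin N) => z (i.succAbove j)) MeasurableSpace.pi)
          (fun z => F₀ N ((Φ N).flow t z)) (localGibbsMeasure σ (a 1) (u₀ 1) (θ₀ 1) N) z
          ∂localGibbsMeasure σ (a 1) (u₀ 1) (θ₀ 1) N) atTop (𝓝 0) →
      ∀ δ' > (0 : ℝ), Tendsto (fun N => localGibbsMeasure σ (a 1) (u₀ 1) (θ₀ 1) N
        {z | δ' < |F₀ N ((Φ N).flow t z) - G 1|}) atTop (𝓝 0) := by
    intro F₀ G k hF₀c hF₀b hFb hGeq c₀ hc₀ hcov hlln0 hRF δ' hδ'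
    have hFm : ∀ N, Measurable fun z => F₀ N ((Φ N).flow t z) := fun N =>
      (hF₀c N).measurable.comp ((Φ N).measurable_flow t)
    -- differentiability of the limit field within `[0,1]`
    have hG : ∀ κ ∈ Icc (0 : ℝ) 1, DifferentiableWithinAt ℝ G (Icc 0 1) κ := by
      intro κ hκ
      have h := (hasDerivWithinAt_integral_mul_consState_apply hρc huc hθc htI hχ k hκ).differentiableWithinAt
      rw [show G = fun κ' => ∫ x, χ x * (consState (ρh κ' t x) (uh κ' t x) (θh κ' t x)) k from funext hGeq]
      exact h
    -- the `κ = 0` anchor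
    have h0 : Tendsto (fun N => ∫ z, F₀ N ((Φ N).flow t z) ∂localGibbsMeasure σ (a 0) (u₀ 0) (θ₀ 0) N)
        atTop (𝓝 (G 0)) := by
      simp_rw [hmeas0, ← hc₀]
      refine tendsto_integral_comp_flow_const σ (a 0 0) (θ₀ 0 0) (u₀ 0 0) hθcpos hcpos.le Φ hinv hprobc
        (fun N => (hF₀c N).measurable) hCχ0 hF₀b (fun δ' hδ' => ?_) t
      simpa only [hlaw0] using hlln0 δ' hδ'
    -- the variance
    have hmem : ∀ N, MemLp (fun z => F₀ N ((Φ N).flow t z)) 2 (localGibbsMeasure σ (a 1) (u₀ 1) (θ₀ 1) N) :=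
      fun N => memLp_two_of_good ha hθs hus ha0 hθ0 σ (Φ N) (fun κ hκ => hprobM κ hκ N) h1I (hFm N) hCχ0 (hFb N)
    have hvar : Tendsto (fun N => Var[fun z => F₀ N ((Φ N).flow t z); localGibbsMeasure σ (a 1) (u₀ 1) (θ₀ 1) N])
        atTop (𝓝 0) :=
      tendsto_zero_of_le_mul (fun N => variance_nonneg _ _) (fun N => hPI N (Φ N) _ (hmem N)) hRF
    exact tendsto_measure_lt_of_uniform_covariance ha hθs hus ha0 hθ0 σ Φ hprobM hFm hCχ0 hFb hG hcov h0 hvar hδ'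
  -- constancy of the `κ = 0` member
  have hρ0t : ∀ x, ρh 0 t x = ρh 0 0 x := fun x => by rw [(hconst0 t htI x).1, (hconst0 0 h0T x).1]
  have hu0t : ∀ x, uh 0 t x = uh 0 0 x := fun x => by rw [(hconst0 t htI x).2.1, (hconst0 0 h0T x).2.1]
  have hθ0t : ∀ x, θh 0 t x = θh 0 0 x := fun x => by rw [(hconst0 t htI x).2.2, (hconst0 0 h0T x).2.2]
  refine ⟨?_, ?_, ?_⟩
  · -- density
    have h := core (fun N z => empiricalDensityField z χ) (fun κ => ∫ x, χ x * ρh κ t x) 0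
      (fun N => continuous_empiricalDensityField hχ) (fun N z => abs_empiricalDensityField_le z hCχ)
      (fun N z hz => abs_empiricalDensityField_flow_le (Φ N) hCχ t hz)
      (fun κ => by simp [consState]) (∫ x, χ x * ρh 0 0 x) (by simp only [hρ0t]) hSd
      (fun δ' hδ' => (hlln 0 h0I χ hχ δ' hδ').1) hRd δ hδ
    simpa using h
  · -- momentum, coordinatewise
    set I : V3 := ∫ x, (χ x * ρh 1 t x) • uh 1 t x with hIdef
    have hIl : ∀ l : Fin 3, I l = ∫ x, χ x * ρh 1 t x * uh 1 t x l := fun l =>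
      integral_smul_apply hχ (hρcont 1 h1I) (hucont 1 h1I) l
    have hI0l : ∀ l : Fin 3, (∫ x, (χ x * ρh 0 0 x) • uh 0 0 x) l = ∫ x, χ x * ρh 0 0 x * uh 0 0 x l := fun l =>
      integral_smul_apply hχ hρcont0 hucont0 l
    have hcoord : ∀ l : Fin 3, Tendsto (fun N => localGibbsMeasure σ (a 1) (u₀ 1) (θ₀ 1) N
        {z | δ / 3 < |(empiricalMomentumField ((Φ N).flow t z) χ - I) l|}) atTop (𝓝 0) := by
      intro l
      have h := core (fun N z => empiricalMomentumField z χ l) (fun κ => ∫ x, χ x * ρh κ t x * uh κ t x l)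
        (HsState.momentumIdx l)
        (fun N => (continuous_apply l).comp
          ((PiLp.continuous_ofLp 2 _).comp (continuous_empiricalMomentumField hχ)))
        (fun N z => abs_empiricalMomentumField_apply_le z hCχ l)
        (fun N z hz => abs_empiricalMomentumField_flow_apply_le (Φ N) hCχ t l hz)
        (fun κ => by simp [consState, mul_assoc]) (∫ x, χ x * ρh 0 0 x * uh 0 0 x l)
        (by simp only [hρ0t, hu0t]) (hSm l)
        (fun δ' hδ' => by
          have hv := tendsto_measure_lt_abs_apply_of_norm (hlln 0 h0I χ hχ δ' hδ').2.1 l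
          refine hv.congr fun N => ?_
          congr 1
          ext z
          simp only [Set.mem_setOf_eq, PiLp.sub_apply, hI0l])
        (hRm l) (δ / 3) (by positivity)
      refine h.congr fun N => ?_
      congr 1
      ext z
      simp only [Set.mem_setOf_eq, PiLp.sub_apply, hIl]
    have hsum : Tendsto (fun N => ∑ l, localGibbsMeasure σ (a 1) (u₀ 1) (θ₀ 1) N
        {z | δ / 3 < |(empiricalMomentumField ((Φ N).flow t z) χ - I) l|}) atTop (𝓝 0) := by
      have := tendsto_finsetSum (Finset.univ : Finset (Fin 3)) (fun l _ => hcoord l)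
      simpa only [Finset.sum_const_zero] using this
    exact tendsto_of_tendsto_of_tendsto_of_le_of_le tendsto_const_nhds hsum (fun N => zero_le) fun N =>
      measure_setOf_lt_norm_le _ (fun z => empiricalMomentumField ((Φ N).flow t z) χ - I) hδ.le
  · -- energy
    have h := core (fun N z => empiricalEnergyField z χ)
      (fun κ => ∫ x, χ x * totalEnergyDensity (ρh κ t x) (uh κ t x) (θh κ t x)) 4
      (fun N => continuous_empiricalEnergyField hχ) (fun N z => abs_empiricalEnergyField_le z hCχ)
      (fun N z hz => abs_empiricalEnergyField_flow_le (Φ N) hCχ t hz)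
      (fun κ => by simp [consState]) (∫ x, χ x * totalEnergyDensity (ρh 0 0 x) (uh 0 0 x) (θh 0 0 x))
      (by simp only [hρ0t, hu0t, hθ0t]) hSe (fun δ' hδ' => (hlln 0 h0I χ hχ δ' hδ').2.2) hRe δ hδ
    simpa using h

end Summit.AtomisticToContinuum.HydrodynamicLimit.Theorems

end
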